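import Literature.Geometry.DiscreteGeometry.SphericalWedgeVolume
import HarnessLib

/-!
# Cone tilings: the solid-angle and dihedral-angle partitions of unity, in facet (H-) form

Topic `Literature/Geometry/DiscreteGeometry`.  A brick of the face theory of spherical
subdivisions (Musin–Tarasov 2012 §3, Prop. 3.4: Euler's formula for the contact graph; Fejes
Tóth's `2N − 4` triangles; the flatness identities `Σ sol = 4π`, `Σ dih = 2π` of route
`AtomisticToContinuum/…/ReggeStarBounds`, items `SolidAngleFlatness` / `DihedralFlatness`), in
the measure-theoretic language of `SolidAngleFraction.lean` (`ballFraction v S = vol(B(v,1) ∩ S)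
/ vol B(v,1)`), for ANY finite-dimensional real inner product space `E` with its canonical
volume.  Everything is PROVED; no named facts.

* `sum_ballFraction_eq_ballFraction_biUnion`, `sum_ballFraction_le_one`,
  `sum_ballFraction_eq_one_of_ball_subset` — ball fractions ADD over a finite family of
  measurable sets with pairwise NULL intersections; the sum is `≤ 1`, and `= 1` when the family
  covers the unit ball (the measure-theoretic core of both flatness identities).
* `argmaxCone F c = {x | ∀ c' ∈ F, ⟪c', x⟫ ≤ ⟪c, x⟫}` — the closed convex cone on which the
  linear functional `⟪c, ·⟫` is the largest of the finitely many `⟪c', ·⟫`, `c' ∈ F`.  When `F`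
  is the set of facet normals of a polytope `P = {x | ⟪c, x⟫ ≤ 1 ∀ c ∈ F}` with `0` in its
  interior, `argmaxCone F c` is the cone from `0` over the facet of `c` (the gauge of `P` is
  `max_c ⟪c, ·⟫`).  The cones COVER (`iUnion_argmaxCone_eq_univ`), two of them meet inside the
  hyperplane `⟪c − c', ·⟫ = 0` (`argmaxCone_inter_subset`), a null set, hence
  **`Σ_{c ∈ F} ballFraction 0 (argmaxCone F c) = 1`** (`sum_ballFraction_argmaxCone`): the solid
  angles at an interior point of the cones over the facets add up to `4π`.
* `dirCone C y = {x | ∃ ε > 0, y + ε x ∈ C}` — the cone of feasible directions of `C` at `y`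
  (for a polyhedral cone: its tangent cone / "angle" at `y`).  For an intersection of finitely
  many closed half-spaces through `0` it is cut out by the constraints ACTIVE at `y`
  (`dirCone_halfspaceCone`), so `dirCone (argmaxCone F c) y = argmaxCone (activeAt F c y) c`
  (`dirCone_argmaxCone`), and for a fixed `y` the feasible cones at `y` of the cones
  `argmaxCone F c` through `y` tile space again:
  **`Σ_{c ∈ F, y ∈ argmaxCone F c} ballFraction 0 (dirCone (argmaxCone F c) y) = 1`**
  (`sum_ballFraction_dirCone_argmaxCone`) — along an edge ray `y` of the facet fan the dihedral
  angles of the facet cones add up to `2π` (the vertex form of Gauss–Bonnet used in Legendre's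
  proof of Euler's formula, `Σ_faces Σ_angles = 2π · #vertices`).

## References
* A.-M. Legendre, *Éléments de géométrie* (1794), Livre VII, Prop. XXV (Euler's formula from
  Girard's theorem: the angle sums at the vertices of a spherical subdivision). [folklore]
* O. R. Musin, A. S. Tarasov, *The strong thirteen spheres problem*, DCG 48 (2012), §3
  (faces of the contact graph, Euler). [`MusinTarasov2012`]
* T. C. Hales, *Dense Sphere Packings*, CUP 2012, §3.2 (solid angle as volume). [`HalesDSP2012`]
-/

noncomputable section

namespace Literature.Geometry.DiscreteGeometry

open Real RealInnerProductSpace MeasureTheory Metric Set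

/-! ### Part S. Ball fractions add over a.e.-disjoint finite families -/

section Sum

variable {E : Type*} [NormedAddCommGroup E] [InnerProductSpace ℝ E] [FiniteDimensional ℝ E]
  [MeasurableSpace E] [BorelSpace E]

/-- **Additivity of ball fractions**: for finitely many measurable sets with pairwise null
intersections, `Σᵢ ballFraction v (S i) = ballFraction v (⋃ᵢ S i)`. [folklore] -/
theorem sum_ballFraction_eq_ballFraction_biUnion {ι : Type*} (s : Finset ι) (v : E)
    {S : ι → Set E} (hS : ∀ i ∈ s, MeasurableSet (S i))
    (hnull : (s : Set ι).Pairwise fun i j => volume (S i ∩ S j) = 0) :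
    ∑ i ∈ s, ballFraction v (S i) = ballFraction v (⋃ i ∈ s, S i) := by
  unfold ballFraction
  rw [← Finset.sum_div, inter_iUnion₂, measure_biUnion_finset₀]
  · rw [ENNReal.toReal_sum]
    intro i _
    exact (measure_lt_top_of_subset inter_subset_left measure_ball_lt_top.ne).ne
  · intro i hi j hj hij
    show volume (ball v 1 ∩ S i ∩ (ball v 1 ∩ S j)) = 0
    exact measure_mono_null (fun x hx => (⟨hx.1.2, hx.2.2⟩ : x ∈ S i ∩ S j)) (hnull hi hj hij)
  · intro i hi
    exact (measurableSet_ball.inter (hS i hi)).nullMeasurableSet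

/-- … hence the sum of the ball fractions of such a family is at most `1` (the inequality half
of the flatness identities). [folklore] -/
theorem sum_ballFraction_le_one {ι : Type*} (s : Finset ι) (v : E) {S : ι → Set E}
    (hS : ∀ i ∈ s, MeasurableSet (S i))
    (hnull : (s : Set ι).Pairwise fun i j => volume (S i ∩ S j) = 0) :
    ∑ i ∈ s, ballFraction v (S i) ≤ 1 := by
  rw [sum_ballFraction_eq_ballFraction_biUnion s v hS hnull]
  exact ballFraction_le_one _ _

/-- … and exactly `1` when the family covers the unit ball at `v` (the equality half).
[folklore] -/
theorem sum_ballFraction_eq_one_of_ball_subset [Nontrivial E] {ι : Type*} (s : Finset ι) (v : E)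
    {S : ι → Set E} (hS : ∀ i ∈ s, MeasurableSet (S i))
    (hnull : (s : Set ι).Pairwise fun i j => volume (S i ∩ S j) = 0)
    (hcover : ball v 1 ⊆ ⋃ i ∈ s, S i) :
    ∑ i ∈ s, ballFraction v (S i) = 1 := by
  rw [sum_ballFraction_eq_ballFraction_biUnion s v hS hnull, ballFraction,
    inter_eq_self_of_subset_left hcover, div_self]
  exact (ENNReal.toReal_pos (measure_ball_pos volume v one_pos).ne' measure_ball_lt_top.ne).ne'

end Sum

/-! ### Part D. Feasible directions of an intersection of half-spaces -/

section DirCone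

variable {E : Type*} [AddCommGroup E] [Module ℝ E]

/-- **The cone of feasible directions** of `C` at `y`: the directions `x` with `y + ε x ∈ C`
for some `ε > 0`.  For a closed convex polyhedral cone `C ∋ y` this is the tangent cone of `C`
at `y` (closed, cut out by the active constraints, `dirCone_halfspaceCone`); at a point of an
edge ray of a polyhedral cone in `ℝ³` it is the dihedral wedge of that edge. [folklore] -/
def dirCone (C : Set E) (y : E) : Set E :=
  {x | ∃ ε : ℝ, 0 < ε ∧ y + ε • x ∈ C}

/-- Membership in `dirCone`, unfolded. [folklore] -/
theorem mem_dirCone_iff (C : Set E) (y x : E) :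
    x ∈ dirCone C y ↔ ∃ ε : ℝ, 0 < ε ∧ y + ε • x ∈ C :=
  Iff.rfl

/-- `dirCone` is monotone in the set. [folklore] -/
theorem dirCone_mono {C D : Set E} (h : C ⊆ D) (y : E) : dirCone C y ⊆ dirCone D y :=
  fun _ ⟨ε, hε, hmem⟩ => ⟨ε, hε, h hmem⟩

/-- **The intersection of finitely many closed half-spaces through `0`**:
`{x | ∀ i ∈ s, 0 ≤ φ i x}` for linear functionals `φ i`. [folklore] -/
def halfspaceCone {ι : Type*} (s : Finset ι) (φ : ι → E →ₗ[ℝ] ℝ) : Set E :=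
  {x | ∀ i ∈ s, 0 ≤ φ i x}

/-- Membership in `halfspaceCone`, unfolded. [folklore] -/
theorem mem_halfspaceCone_iff {ι : Type*} (s : Finset ι) (φ : ι → E →ₗ[ℝ] ℝ) (x : E) :
    x ∈ halfspaceCone s φ ↔ ∀ i ∈ s, 0 ≤ φ i x :=
  Iff.rfl

/-- **The feasible directions of an intersection of half-spaces at a point of it are cut out
by the ACTIVE constraints** (`φ i y = 0`): the inactive ones (`φ i y > 0`) stay slack along
every direction for small `ε`, finitely many at a time. [folklore] -/
theorem dirCone_halfspaceCone {ι : Type*} [DecidableEq ι] (s : Finset ι) (φ : ι → E →ₗ[ℝ] ℝ)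
    {y : E} (hy : y ∈ halfspaceCone s φ) :
    dirCone (halfspaceCone s φ) y = halfspaceCone (s.filter fun i => φ i y = 0) φ := by
  ext x
  constructor
  · rintro ⟨ε, hε, hmem⟩ i hi
    rw [Finset.mem_filter] at hi
    have h := hmem i hi.1
    rw [map_add, map_smul, hi.2, zero_add, smul_eq_mul] at h
    nlinarith
  · intro hx
    -- the inactive constraints and their slack
    set I : Finset ι := s.filter fun i => φ i y ≠ 0 with hI
    have hslack : ∀ i ∈ I, 0 < φ i y := fun i hi => by
      rw [hI, Finset.mem_filter] at hi
      exact lt_of_le_of_ne (hy i hi.1) (Ne.symm hi.2)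
    by_cases hIne : I.Nonempty
    · -- `ε = min over inactive i of (φ i y) / (|φ i x| + 1)`
      obtain ⟨i₀, hi₀, hmin⟩ := I.exists_min_image (fun i => φ i y / (|φ i x| + 1)) hIne
      set ε : ℝ := φ i₀ y / (|φ i₀ x| + 1) with hε
      have hεpos : 0 < ε := div_pos (hslack i₀ hi₀) (by positivity)
      refine ⟨ε, hεpos, fun i his => ?_⟩
      rw [map_add, map_smul, smul_eq_mul]
      by_cases hact : φ i y = 0
      · have h0 : 0 ≤ φ i x := hx i (by rw [Finset.mem_filter]; exact ⟨his, hact⟩)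
        rw [hact, zero_add]
        exact mul_nonneg hεpos.le h0
      · have hiI : i ∈ I := by rw [hI, Finset.mem_filter]; exact ⟨his, hact⟩
        have hle : ε ≤ φ i y / (|φ i x| + 1) := hmin i hiI
        rw [le_div_iff₀ (by positivity)] at hle
        have h1 : -(ε * φ i x) ≤ ε * |φ i x| := by
          rw [← mul_neg]
          exact mul_le_mul_of_nonneg_left (neg_le_abs _) hεpos.le
        nlinarith [abs_nonneg (φ i x)]
    · refine ⟨1, one_pos, fun i his => ?_⟩
      have hact : φ i y = 0 := by
        by_contra hne
        exact hIne ⟨i, by rw [hI, Finset.mem_filter]; exact ⟨his, hne⟩⟩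
      have h0 : 0 ≤ φ i x := hx i (by rw [Finset.mem_filter]; exact ⟨his, hact⟩)
      rw [map_add, one_smul, hact, zero_add]
      exact h0

/-- A `halfspaceCone` is contained in its cone of feasible directions at each of its points
(it is a convex cone: `y + x ∈ C` for `x, y ∈ C`). [folklore] -/
theorem halfspaceCone_subset_dirCone {ι : Type*} (s : Finset ι) (φ : ι → E →ₗ[ℝ] ℝ) {y : E}
    (hy : y ∈ halfspaceCone s φ) : halfspaceCone s φ ⊆ dirCone (halfspaceCone s φ) y :=
  fun x hx => ⟨1, one_pos, fun i hi => by
    rw [map_add, one_smul]; exact add_nonneg (hy i hi) (hx i hi)⟩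

end DirCone

/-! ### Part A. Argmax cones of finitely many linear functionals -/

section Argmax

variable {E : Type*} [NormedAddCommGroup E] [InnerProductSpace ℝ E]

/-- **The argmax cone** of `c` relative to the finite set `F`: the closed convex cone of the
`x` at which `⟪c, x⟫` is the largest of the `⟪c', x⟫`, `c' ∈ F`.  For the facet normals `F` of
a polytope with `0` in its interior (`P = {x | ⟪c, x⟫ ≤ 1 ∀ c ∈ F}`) this is the cone from `0`
over the facet of `c`. [folklore] -/
def argmaxCone (F : Finset E) (c : E) : Set E :=
  {x | ∀ c' ∈ F, ⟪c', x⟫ ≤ ⟪c, x⟫}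

/-- Membership in `argmaxCone`, unfolded. [folklore] -/
theorem mem_argmaxCone_iff (F : Finset E) (c x : E) :
    x ∈ argmaxCone F c ↔ ∀ c' ∈ F, ⟪c', x⟫ ≤ ⟪c, x⟫ :=
  Iff.rfl

/-- The argmax cone as an intersection of closed half-spaces through `0` with normals
`c − c'`. [folklore] -/
theorem argmaxCone_eq_halfspaceCone (F : Finset E) (c : E) :
    argmaxCone F c = halfspaceCone F fun c' => innerₗ E (c - c') := by
  ext x
  simp only [argmaxCone, halfspaceCone, mem_setOf_eq, innerₗ_apply_apply, inner_sub_left,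
    sub_nonneg]

/-- `0` lies in every argmax cone. [folklore] -/
theorem zero_mem_argmaxCone (F : Finset E) (c : E) : (0 : E) ∈ argmaxCone F c :=
  fun c' _ => by rw [inner_zero_right, inner_zero_right]

/-- Argmax cones are invariant under nonnegative dilations. [folklore] -/
theorem smul_mem_argmaxCone {F : Finset E} {c x : E} (hx : x ∈ argmaxCone F c) {t : ℝ}
    (ht : 0 ≤ t) : t • x ∈ argmaxCone F c := fun c' hc' => by
  rw [real_inner_smul_right, real_inner_smul_right]
  exact mul_le_mul_of_nonneg_left (hx c' hc') ht

/-- Argmax cones are closed under addition. [folklore] -/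
theorem add_mem_argmaxCone {F : Finset E} {c x y : E} (hx : x ∈ argmaxCone F c)
    (hy : y ∈ argmaxCone F c) : x + y ∈ argmaxCone F c := fun c' hc' => by
  rw [inner_add_right, inner_add_right]
  exact add_le_add (hx c' hc') (hy c' hc')

/-- Argmax cones are convex. [folklore] -/
theorem convex_argmaxCone (F : Finset E) (c : E) : Convex ℝ (argmaxCone F c) := by
  intro x hx y hy a b ha hb _
  exact add_mem_argmaxCone (smul_mem_argmaxCone hx ha) (smul_mem_argmaxCone hy hb)

/-- Argmax cones are closed. [folklore] -/
theorem isClosed_argmaxCone (F : Finset E) (c : E) : IsClosed (argmaxCone F c) := by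
  have : argmaxCone F c = ⋂ c' ∈ F, {x : E | ⟪c', x⟫ ≤ ⟪c, x⟫} := by
    ext x; simp only [argmaxCone, mem_setOf_eq, mem_iInter]
  rw [this]
  exact isClosed_biInter fun c' _ => isClosed_le (by fun_prop) (by fun_prop)

/-- **The argmax cones cover**: every `x` lies in the argmax cone of a maximiser of
`c ↦ ⟪c, x⟫` over the nonempty finite set `F`. [folklore] -/
theorem exists_mem_argmaxCone (F : Finset E) (hF : F.Nonempty) (x : E) :
    ∃ c ∈ F, x ∈ argmaxCone F c := by
  obtain ⟨c, hc, hmax⟩ := F.exists_max_image (fun c' => ⟪c', x⟫) hF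
  exact ⟨c, hc, fun c' hc' => hmax c' hc'⟩

/-- … i.e. `⋃_{c ∈ F} argmaxCone F c = E`. [folklore] -/
theorem iUnion_argmaxCone_eq_univ (F : Finset E) (hF : F.Nonempty) :
    ⋃ c ∈ F, argmaxCone F c = univ :=
  eq_univ_of_forall fun x => by
    obtain ⟨c, hc, h⟩ := exists_mem_argmaxCone F hF x
    exact mem_iUnion₂.2 ⟨c, hc, h⟩

/-- **Two argmax cones meet inside the hyperplane `⟪c − c', ·⟫ = 0`.** [folklore] -/
theorem argmaxCone_inter_subset {F : Finset E} {c c' : E} (hc : c ∈ F) (hc' : c' ∈ F) :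
    argmaxCone F c ∩ argmaxCone F c' ⊆ {x | ⟪c - c', x⟫ = 0} := fun x hx => by
  rw [mem_setOf_eq, inner_sub_left, sub_eq_zero]
  exact le_antisymm (hx.2 c hc) (hx.1 c' hc')

/-- The value `⟪c, y⟫` is the same for all `c` whose argmax cone contains `y` (it is the
maximum). [folklore] -/
theorem inner_eq_inner_of_mem_argmaxCone {F : Finset E} {c₁ c₂ y : E} (hc₁ : c₁ ∈ F)
    (hc₂ : c₂ ∈ F) (h₁ : y ∈ argmaxCone F c₁) (h₂ : y ∈ argmaxCone F c₂) :
    ⟪c₁, y⟫ = ⟪c₂, y⟫ :=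
  le_antisymm (h₂ c₁ hc₁) (h₁ c₂ hc₂)

open Classical in
/-- **The members of `F` active at `y`** relative to `c`: those with `⟪c', y⟫ = ⟪c, y⟫`.
[folklore] -/
def activeAt (F : Finset E) (c y : E) : Finset E :=
  F.filter fun c' => ⟪c', y⟫ = ⟪c, y⟫

/-- Membership in `activeAt`. [folklore] -/
theorem mem_activeAt {F : Finset E} {c y c' : E} :
    c' ∈ activeAt F c y ↔ c' ∈ F ∧ ⟪c', y⟫ = ⟪c, y⟫ := by
  unfold activeAt
  rw [Finset.mem_filter]

/-- `activeAt F c y ⊆ F`. [folklore] -/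
theorem activeAt_subset (F : Finset E) (c y : E) : activeAt F c y ⊆ F :=
  fun _ h => (mem_activeAt.1 h).1

/-- `c` itself is active (when `c ∈ F`). [folklore] -/
theorem self_mem_activeAt {F : Finset E} {c : E} (hc : c ∈ F) (y : E) : c ∈ activeAt F c y :=
  mem_activeAt.2 ⟨hc, rfl⟩

/-- **The feasible directions of an argmax cone at one of its points form the argmax cone of
the active sub-family.** [folklore] -/
theorem dirCone_argmaxCone {F : Finset E} {c y : E} (hy : y ∈ argmaxCone F c) :
    dirCone (argmaxCone F c) y = argmaxCone (activeAt F c y) c := by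
  classical
  rw [argmaxCone_eq_halfspaceCone, argmaxCone_eq_halfspaceCone,
    dirCone_halfspaceCone F _ (by rwa [← argmaxCone_eq_halfspaceCone])]
  congr 1
  ext c'
  rw [Finset.mem_filter, mem_activeAt, innerₗ_apply_apply, inner_sub_left, sub_eq_zero, eq_comm]

/-- An argmax cone lies in its cone of feasible directions at each of its points. [folklore] -/
theorem argmaxCone_subset_dirCone {F : Finset E} {c y : E} (hy : y ∈ argmaxCone F c) :
    argmaxCone F c ⊆ dirCone (argmaxCone F c) y :=
  fun x hx => ⟨1, one_pos, by rw [one_smul]; exact add_mem_argmaxCone hy hx⟩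

/-- **When `y ∈ argmaxCone F c`, the active family at `y` is the set `M` of ALL maximisers of
`⟪·, y⟫`**, the same for every such `c`. [folklore] -/
theorem activeAt_eq_of_mem_argmaxCone {F M : Finset E} {c y : E} (hc : c ∈ F)
    (hy : y ∈ argmaxCone F c) (hM : ∀ c', c' ∈ M ↔ c' ∈ F ∧ y ∈ argmaxCone F c') :
    activeAt F c y = M := by
  ext c'
  rw [mem_activeAt, hM]
  refine ⟨fun h => ⟨h.1, fun c'' hc'' => h.2 ▸ hy c'' hc''⟩, fun h => ⟨h.1, ?_⟩⟩
  exact inner_eq_inner_of_mem_argmaxCone h.1 hc h.2 hy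

variable [FiniteDimensional ℝ E] [MeasurableSpace E] [BorelSpace E]

omit [FiniteDimensional ℝ E] in
/-- Argmax cones are measurable. [folklore] -/
theorem measurableSet_argmaxCone (F : Finset E) (c : E) : MeasurableSet (argmaxCone F c) :=
  (isClosed_argmaxCone F c).measurableSet

/-- **Distinct argmax cones overlap in a null set.** [folklore] -/
theorem volume_argmaxCone_inter {F : Finset E} {c c' : E} (hc : c ∈ F) (hc' : c' ∈ F)
    (hne : c ≠ c') : volume (argmaxCone F c ∩ argmaxCone F c') = 0 :=
  measure_mono_null (argmaxCone_inter_subset hc hc') (volume_inner_eq_zero (sub_ne_zero.2 hne))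

/-- **The solid-angle partition of unity, facet form.**  The fractions of the unit ball inside
the argmax cones of a nonempty finite set `F` of functionals sum to `1`: for a polytope with
`0` in its interior, the solid angles at `0` of the cones over its facets add up to `4π`
(in `ℝ³`; to the full sphere measure in general). [folklore] -/
theorem sum_ballFraction_argmaxCone [Nontrivial E] (F : Finset E) (hF : F.Nonempty) :
    ∑ c ∈ F, ballFraction (0 : E) (argmaxCone F c) = 1 :=
  sum_ballFraction_eq_one_of_ball_subset F 0 (fun c _ => measurableSet_argmaxCone F c)
    (fun _ hc _ hc' hne => volume_argmaxCone_inter hc hc' hne)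
    (by rw [iUnion_argmaxCone_eq_univ F hF]; exact subset_univ _)

/-- **The dihedral-angle (vertex) partition of unity, facet form.**  Fix `y` and let `M ⊆ F`
be the set of maximisers of `⟪·, y⟫` (the `c` whose argmax cone contains `y`).  Then the
fractions of the unit ball inside the feasible cones at `y` of these argmax cones sum to `1`:
in `ℝ³`, along the ray of a vertex `y` of the facet fan, the dihedral angles of the facet cones
through `y` add up to `2π` — the vertex identity of Legendre's proof of Euler's formula.
[folklore] -/
theorem sum_ballFraction_dirCone_argmaxCone [Nontrivial E] (F M : Finset E) (y : E)
    (hF : F.Nonempty) (hM : ∀ c, c ∈ M ↔ c ∈ F ∧ y ∈ argmaxCone F c) :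
    ∑ c ∈ M, ballFraction (0 : E) (dirCone (argmaxCone F c) y) = 1 := by
  have hMne : M.Nonempty := by
    obtain ⟨c, hc, hyc⟩ := exists_mem_argmaxCone F hF y
    exact ⟨c, (hM c).2 ⟨hc, hyc⟩⟩
  rw [Finset.sum_congr rfl fun c hc => by
    rw [dirCone_argmaxCone ((hM c).1 hc).2,
      activeAt_eq_of_mem_argmaxCone ((hM c).1 hc).1 ((hM c).1 hc).2 hM]]
  exact sum_ballFraction_argmaxCone M hMne

end Argmax

end Literature.Geometry.DiscreteGeometry
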